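import Summits.QuantumFields.BalabanUV.T4Continuum.Support.ShellMeasureLandauEndWindowRestrict

/-!
# `T4Continuum.ShellMeasureLandauEndWindowRestrictRel` — row S87 f2b: the live-level END-II-final with the window binder
# replaced by the SUPPORT-RELATIVE reach reading `hreach′ : u < θ → F ≠ 0 → window` (the γ3 input of record is a PAIR:
# core reading from `u < θ` + collar support reading from `F ≠ 0`)
(cell `pub-balaban`, sub-cell `t4`, spine estimate NE7c (node U5b); NE7c ROUND-2 crew, unit
`b2b-balaban-t4-ne7c-formalise-leaf-03` gen 6; owner table `t4/b2b-balaban-t4-ne7c-p1/LEAVES-NE7c-P1.md` row **S87**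
(f2 `ShellMeasureLandauEndWindowRestrict` p229117 = this lineage; amendment «γ3 COLLAR» leaf-01-g8 journal l.18489, leaf-08-g14
CONCUR l.18568, my RESPONSE l.18592 — option (α): the twin END is hosted here, in a NEW file because f2 is 343 l.);
ADDITIVE — imports f2 ONLY (its §1∕§2 star-shapedness lemmas BY NAME; the §3 proof body re-run with ONE use site changed);
[folklore]; 0 `def`, 0 `def … : Prop`, 0 sorry, 0 citation tags)

HONEST FRAMING.  Finite four-torus programme, rung (B)+1 only — NOT infinite volume, NOT a mass gap, NOT the Clay
problem, NOT summit progress; (B), `BetaPertHyp`, (B^μ) not consumed.  NE7c (`T4IndicatorShell.ShellWeightBound`) is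
NOT PRINTED in [Balaban 1983–89] and NOT PROVED; «NE7c ⇐ the named binders» (trigger c3); (M1) realized ≠ NE7c.
Nothing printed is asserted: B14 (2.16)∕(2.17), B15 (1.3)–(1.9), [Balaban1985Averaging] Props 1∕2 LOCATE displayed SHAPES
only; no estimate of Bałaban's is discharged.  HONEST DEPENDENCY (cell): continuum YM on T⁴ ⇐ BetaPertH ∧ nine spine
estimates (0/9 proved); BetaPertH ⇐ (D1) ∧ (D4) ∧ CAP+tail; G-an2-4 gates asym, D1 and NE2/3/4.

THE POINT (leaf-01-g8's XREAD INFO C-ne7cleaf01g8-1 on S87, page render B14 p. 257).  (2.17)'s sup runs over `□^∼` (ONE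
cube layer) while the block is `□^{∼4}`: the slot's OWN sub-threshold event windows the plaquettes of `□^∼` only; the
collar `□^{∼4} ∖ □^∼` is small because the SAME term carries the neighbouring cubes' kept (2.17)-co-tests and the `T_k`
restrictions — FACTORS of the density `F`, a SUPPORT property (S2's level-0 mechanism `plaqSmallOn_of_cover`).  So the
honest reach binder is SUPPORT-RELATIVE: `hreach′ : u(W) < θ → F(W) ≠ 0 → window`.  f2's END `…_final_of_reach` uses its
reach binder at ONE place, where `(𝟙{u<θ}·F)(W) ≠ 0` yields BOTH conjuncts — so the END holds VERBATIM with `hreach′`: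
* **`slotAC_realized_su2_landauChart_final_of_reach'`** — S76 f2's binders VERBATIM except `hFsupp`, REPLACED by `hreach′`;
  conclusion IDENTICAL: `SlotAntiConcentration ((fieldMeasure P j SU2).withDensity F) u (εθ·η²) ρ (2(m₀ + (B_W + B_E))∕(1−δ))`
  (f2's `…_of_reach` is the special case `hreach′ := fun V y h _ ↦ hreach V y h`).
The box-level producer of `hreach′` is leaf-01-g8's `ShellMeasureWindowReachCollar.hreach'_of_core_collar` (core reading on
`A ⊇ plaqs(□^∼)`, collar support reading on `B`, cover `boxPlaqs ⊆ A ∪ B`, S1's reach via S87 f3 `dist1_section_le`); the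
END-TO-END composition is S87 f4 `ShellMeasureLandauEndWindowReach`.  NOTHING in the countdown moves; NE7c NOT PROVED;
spine PROVED 0∕9.
-/

noncomputable section

open Set Metric NormedSpace MeasureTheory Function

namespace Summit.QuantumFields.BalabanUV.T4Continuum.ShellMeasureLandauEndWindowRestrictRel

open scoped ENNReal
open Literature.MathematicalPhysics.QuantumFieldTheory.Balaban1983to89
open B11Prop6Scheme (Prop4Hyp)
open GaugeField (GaugeInvariant)
open T4ShellMeasure (SlotAntiConcentration)
open T4CubePoincare (cube)
open T4CubeChartGnomonic (SU2)
open T4CubeChartExp (expFibreChart)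
open T4TreeGaugeFixing (NoClosedLoop fixTo)
open T4ShellMeasurePlaquette (expTail₂)
open ShellMeasureLevelAssembly (classifier)
open ShellMeasureLandauHolonomy (solAt landauExp)
open ShellMeasureLandauHolonomyChart (holOf cplx)
open ShellMeasureLandauHolonomySkew (readOutReal)
open ShellMeasureLandauHolonomyStokes (hAN_landau_chartRay_stokes hSM_of_stokes)
open ShellMeasureLandauPrinted (scheme_numbers_of_printed sectC_numbers_of_printed)
open ShellMeasureLandauEndFinal (slotAC_realized_su2_landauChart_final)
open ShellMeasureWindowRestrict (measurable_indicator_density indicator_mul_invariant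
  slotAntiConcentration_withDensity_of_indicator)
open ShellMeasureLandauEndWindowRestrict (classifier_lt_of_contraction mem_cube_of_mem_closedBall
  exp_neg_smul_mem_closedBall)

section Final

open scoped Matrix.Norms.L2Operator

variable {P : Params} {j : ℕ} [DecidableEq (PBond P j)]
variable {n : Type*} [Fintype n] [DecidableEq n] [Nonempty n]
variable {𝒴 𝒴' 𝒳 𝒵 ℬ : Type*} [NormedAddCommGroup 𝒴] [NormedSpace ℂ 𝒴] [CompleteSpace 𝒴]
  [NormedAddCommGroup 𝒴'] [NormedSpace ℂ 𝒴'] [NormedAddCommGroup 𝒳] [NormedSpace ℂ 𝒳] [CompleteSpace 𝒳]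
  [NormedAddCommGroup 𝒵] [NormedSpace ℂ 𝒵] [NormedAddCommGroup ℬ] [NormedSpace ℂ ℬ]

/-- **END-II-FINAL WITH THE SUPPORT-RELATIVE REACH READING (row S87 f2b).**  Hypotheses: those of S76 f2
`ShellMeasureLandauEndFinal.slotAC_realized_su2_landauChart_final` VERBATIM except the window-support binder `hFsupp`,
REPLACED by `hreach′ : u(W) < εθ·η² → F(W) ≠ 0 → every tree-gauged block bond of W within 2 sin(S∕2) of the centre`
(the γ3 input in its honest form: the sub-threshold event windows `□^∼`, the density's kept co-tests window the collar —
located readings of printed TYPE, NOT asserted).  CONCLUSION — IDENTICAL to S76 f2's.  Proof: S76 f2 for the restricted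
density `𝟙{u < εθη²}·F` with the co-test `Jco·𝟙{u∘section < εθη²}` — centre-monotone because the classifier's sub-threshold
set is STAR-SHAPED along the contraction (f2 `classifier_lt_of_contraction` on S73's (AN-bound) + `hSM_of_stokes`) — then
S87 f1 `slotAntiConcentration_withDensity_of_indicator`.  CONDITIONAL on every binder; NOT Bałaban's minimiser; (M1)
realized ≠ NE7c. [folklore] -/
theorem slotAC_realized_su2_landauChart_final_of_reach' {T : Finset (PBond P j)} (hT : NoClosedLoop T)
    (U₀ : GaugeField P j SU2) (Λ : Finset (PBond P j)) {m₀ : ℕ} (e : ↥Λ × Fin 3 ≃ Fin m₀)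
    {S : ℝ} (hS : 0 < S) (hSπ : 3 * S ^ 2 < Real.pi ^ 2) (c : GaugeField P j SU2 → GaugeField P j SU2)
    {F : GaugeField P j SU2 → ℝ≥0∞} (hF : Measurable F) (hFi : GaugeInvariant F)
    {u : GaugeField P j SU2 → ℝ} (hu : Measurable u) (hui : GaugeInvariant u)
    {ι : Type*} {Pu : Finset ι} (hPu : Pu.Nonempty)
    (W : GaugeField P j SU2 → Set (Fin m₀ → ℝ)) (Jco : GaugeField P j SU2 → (Fin m₀ → ℝ) → ℝ≥0∞)
    {δ ρ β : ℝ}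
    (𝒢 : GaugeField P j SU2 → (𝒵 →L[ℂ] 𝒴)) (W𝒱 : GaugeField P j SU2 → 𝒴 → 𝒵) {B₀ C₄ a₃ ε₄ : ℝ}
    (h𝒢 : ∀ V f, ‖𝒢 V f‖ ≤ B₀ * ‖f‖) (hW : ∀ V, Prop4Hyp (W𝒱 V) C₄ a₃) (hB₀ : 0 < B₀) (hC₄ : 0 ≤ C₄)
    (hε₄ : 0 ≤ ε₄)
    {dL C₁ B₃ ε₁ : ℝ} (hdL : 0 ≤ dL) (hC₁ : 0 ≤ C₁) (hε₁ : 0 ≤ ε₁) (hB₃ : dL ≤ B₃)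
    (h1 : 2 * B₀ * C₁ * B₃ * ε₁ ≤ ε₄) (h2 : 4 * ε₄ ≤ a₃) (h3 : 16 * B₀ * C₄ * ε₄ ≤ 1)
    (H₁ : GaugeField P j SU2 → (ℬ →L[ℂ] 𝒴)) (hH₁ : ∀ V B, ‖H₁ V B‖ ≤ B₀ * ‖B‖)
    (Φ : GaugeField P j SU2 → (Fin m₀ → ℂ) → ℬ) {rΦ : ℝ} (hΦd : ∀ V, DifferentiableOn ℂ (Φ V) (ball 0 rΦ))
    (hΦ0 : ∀ V, Φ V 0 = 0) (hΦ : ∀ V, ∀ z ∈ ball (0 : Fin m₀ → ℂ) rΦ, ‖Φ V z‖ < 2 * dL * C₁ * ε₁) (hSr : S < rΦ)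
    (Cf : GaugeField P j SU2 → 𝒴' → 𝒳) {C₂ RC : ℝ} (hC₂ : 0 ≤ C₂)
    (hCq : ∀ V, ∀ Z : 𝒴', ‖Z‖ < RC → ‖Cf V Z‖ ≤ C₂ * ‖Z‖ ^ 2) (hCd : ∀ V, DifferentiableOn ℂ (Cf V) (ball 0 RC))
    (ιs : GaugeField P j SU2 → (𝒴 →L[ℂ] 𝒴')) (hι : ∀ V Y, ‖ιs V Y‖ ≤ ‖Y‖)
    (Hop : GaugeField P j SU2 → (𝒳 →L[ℂ] 𝒴)) (hH : ∀ V X, ‖Hop V X‖ ≤ B₀ * ‖X‖)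
    {ε₃ : ℝ} (h18 : 18 * C₂ * B₀ * ε₃ ≤ 1) (hcoup : ε₄ + B₀ * (2 * dL * C₁ * ε₁) ≤ ε₃) (h3R : 3 * ε₃ ≤ RC)
    (ℓs : ι → List (𝒴 →L[ℂ] Matrix n n ℂ)) {κr : ℝ} (hκ : 0 ≤ κr)
    (hℓ : ∀ p ∈ Pu, ∀ ℓ ∈ ℓs p, ∀ Y, ‖ℓ Y‖ ≤ κr * ‖Y‖) {m : ℕ} (hlen : ∀ p ∈ Pu, (ℓs p).length ≤ m)
    {κc : ℝ} (hκc : 0 ≤ κc) (hcurl : ∀ p ∈ Pu, ∀ Y, ‖((ℓs p).map fun ℓ => ℓ Y).sum‖ ≤ κc * ‖Y‖)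
    -- THE TWO 𝓔-SLOTS (R-ne7cp1-g31-1): the WILSON part `𝓔W` (S74 `hE_landau_wilsonSquares(_pinned)` fills `hEW`; the Wilson
    -- density is nonnegative: `hWlb`) and the NON-WILSON part `𝓔E` (S71 f2 ∕ S78 fills `hEE`; a displayed lower bound `hElb`)
    (𝓔W 𝓔E : GaugeField P j SU2 → (Fin m₀ → ℝ) → ℝ) {BW BE BElb : ℝ}
    (hEW : ∀ V, ∀ x ∈ W V, ∀ c' : ℝ, 1 / 2 ≤ c' → c' ≤ 1 → 𝓔W V (c' • x) ≤ 𝓔W V x + (1 - c') * BW) (hBW : 0 ≤ BW)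
    (hEE : ∀ V, ∀ x ∈ W V, ∀ c' : ℝ, 1 / 2 ≤ c' → c' ≤ 1 → 𝓔E V (c' • x) ≤ 𝓔E V x + (1 - c') * BE) (hBE : 0 ≤ BE)
    (hWlb : ∀ V (y : Fin m₀ → ℝ), ‖y‖ ≤ S → 0 ≤ 𝓔W V y)
    (hElb : ∀ V (y : Fin m₀ → ℝ), ‖y‖ ≤ S → -BElb ≤ 𝓔E V y)
    (L : Set (𝒴 →L[ℂ] Matrix n n ℂ))
    (𝓡𝒵 : AddSubgroup 𝒵) (𝓡𝒴' : AddSubgroup 𝒴') (𝓡𝒳 : AddSubgroup 𝒳) (h𝓡𝒳 : IsClosed (𝓡𝒳 : Set 𝒳))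
    (𝓡ℬ : AddSubgroup ℬ)
    (h𝒢r : ∀ V, ∀ f ∈ 𝓡𝒵, 𝒢 V f ∈ readOutReal L) (hWr : ∀ V, ∀ Y ∈ readOutReal L, W𝒱 V Y ∈ 𝓡𝒵)
    (hιr : ∀ V, ∀ Y ∈ readOutReal L, ιs V Y ∈ 𝓡𝒴') (hHr : ∀ V, ∀ X ∈ 𝓡𝒳, Hop V X ∈ readOutReal L)
    (hCr : ∀ V, ∀ Z ∈ 𝓡𝒴', Cf V Z ∈ 𝓡𝒳) (hH₁r : ∀ V, ∀ B ∈ 𝓡ℬ, H₁ V B ∈ readOutReal L)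
    (hΦr : ∀ V, ∀ y : Fin m₀ → ℝ, ‖y‖ ≤ S → Φ V (cplx y) ∈ 𝓡ℬ)
    (hRdict : ∀ V, ∀ x ∈ cube m₀ S,
      F (fixTo T U₀ (updateFinset V Λ (expFibreChart Λ (c V) e x))) =
        Jco V x * ENNReal.ofReal (Real.exp (-(𝓔W V x + 𝓔E V x))))
    (hudict : ∀ V, ∀ x ∈ cube m₀ S,
      u (fixTo T U₀ (updateFinset V Λ (expFibreChart Λ (c V) e x))) =
        classifier hPu (fun p => holOf (ℓs p) (fun y => landauExp (Cf V) (ιs V) (Hop V)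
          (4 * C₂ * (ε₄ + B₀ * (2 * dL * C₁ * ε₁)) ^ 2)
          (solAt (𝒢 V) 0 (W𝒱 V) ε₄ (0 : 𝒵) (H₁ V (Φ V (cplx y))) + H₁ V (Φ V (cplx y))))) x)
    (hJW : ∀ V x, Jco V x ≠ 0 → x ∈ W V)
    (hJ : ∀ V x, ∀ a : ℝ, 0 ≤ a → Jco V x ≤ Jco V (Real.exp (-a) • x))
    (hJ1 : ∀ V x, Jco V x ≤ 1)
    (hWS : ∀ V, W V ⊆ closedBall (0 : Fin m₀ → ℝ) S)
    (hδ0 : 0 ≤ δ) (hδ1 : δ < 1) (hρ0 : 0 ≤ ρ) (hρ : ρ ≤ (1 - δ) / 2) (hβ : 0 ≤ β)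
    -- SM-L2 (SM) DISCHARGED IN THE STOKES CURRENCY (S73 `hSM_of_stokes`): the η-scalings of the classifier's read-out data
    -- DISPLAYED — curl read-out × field size `κ_c·z̄ ≤ c₁η²z` (B11 (25)∕(37) TYPE), letter size `κ_r·z̄ ≤ c₂ηz` ((19) TYPE),
    -- regime `m·κ_r·z̄ ≤ 1` — the UNIT-currency smallness `36(c₁z + m²c₂²z²)∕(r_Φ∕S − 1)² ≤ δ·εθ`, and the classifier
    -- threshold `θ := εθ·η²` (B14 (2.17) TYPE): the `η²` CANCELS
    {η εθ c₁ c₂ z : ℝ} (hη : 0 < η) (hεθ : 0 < εθ)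
    -- THE SUPPORT-RELATIVE REACH READING (leaf-01-g8's amendment l.18489 ∕ leaf-08-g14 l.18568; produced on the block's
    -- box by `ShellMeasureWindowReachCollar.hreach'_of_core_collar` from the PAIR «sub-threshold ⟹ plaquettes of `□^∼`
    -- small» (core, from `u < θ`) + «`F ≠ 0` ⟹ collar plaquettes small» (the kept co-tests — a SUPPORT property of `F`) —
    -- located, printed TYPE, NOT asserted) — REPLACES the window-support binder `hFsupp` of S76 f2
    (hreach' : ∀ V y, u (fixTo T U₀ (updateFinset V Λ y)) < εθ * η ^ 2 → F (fixTo T U₀ (updateFinset V Λ y)) ≠ 0 →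
      ∀ b (hb : b ∈ Λ), dist1 ((c V b)⁻¹ * y ⟨b, hb⟩) ≤ 2 * Real.sin (S / 2))
    (hs₁ : κc * ((ε₄ + B₀ * (2 * dL * C₁ * ε₁)) + B₀ * (4 * C₂ * (ε₄ + B₀ * (2 * dL * C₁ * ε₁)) ^ 2)) ≤ c₁ * η ^ 2 * z)
    (ha : κr * ((ε₄ + B₀ * (2 * dL * C₁ * ε₁)) + B₀ * (4 * C₂ * (ε₄ + B₀ * (2 * dL * C₁ * ε₁)) ^ 2)) ≤ c₂ * η * z)
    (hma : m * (κr * ((ε₄ + B₀ * (2 * dL * C₁ * ε₁)) + B₀ * (4 * C₂ * (ε₄ + B₀ * (2 * dL * C₁ * ε₁)) ^ 2))) ≤ 1)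
    (hsm : 36 * (c₁ * z + m ^ 2 * c₂ ^ 2 * z ^ 2) / (rΦ / S - 1) ^ 2 ≤ δ * εθ) :
    SlotAntiConcentration ((fieldMeasure P j SU2).withDensity F) u (εθ * η ^ 2) ρ
      (2 * ((m₀ : ℝ) + (BW + BE)) / (1 - δ)) := by
  -- numbers: the chart radius in window units, the threshold, (SM) in the Stokes currency (S73)
  have hRad1 : 1 < rΦ / S := by rw [lt_div_iff₀ hS]; linarith
  have hθ : 0 < εθ * η ^ 2 := by positivity
  have hκz : 0 ≤ κr * ((ε₄ + B₀ * (2 * dL * C₁ * ε₁)) + B₀ * (4 * C₂ * (ε₄ + B₀ * (2 * dL * C₁ * ε₁)) ^ 2)) := by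
    positivity
  have hSM := hSM_of_stokes (δ := δ) hRad1 hη hκz hs₁ ha hma hsm
  -- the printed smallness gives the scheme numerics ((118)∕(121) at the ray; (54) at `ε₄ + 2dLB₀C₁ε₁`)
  obtain ⟨hdom, hself, hcontr, -⟩ := scheme_numbers_of_printed hdL hB₀.le hC₁ hC₄ hε₁ hε₄ hB₃ h1 h2 h3
  have hself' : B₀ * C₄ * (ε₄ + B₀ * (2 * dL * C₁ * ε₁)) ^ 2 ≤ ε₄ := by simpa using hself
  have hcontr' : 4 * B₀ * C₄ * (ε₄ + B₀ * (2 * dL * C₁ * ε₁)) < 1 := by simpa using hcontr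
  obtain ⟨hq, hRC⟩ := sectC_numbers_of_printed hC₂ hB₀.le h18 hcoup h3R
  -- the window points lie in the chart cube
  have hWc : ∀ V, ∀ x ∈ W V, x ∈ cube m₀ S := fun V x hx => mem_cube_of_mem_closedBall (hWS V hx)
  -- S76 f2 for the RESTRICTED density with the indicator-multiplied co-test
  have h := slotAC_realized_su2_landauChart_final hT U₀ Λ e hS hSπ c
    (F := {U | u U < εθ * η ^ 2}.indicator F) (measurable_indicator_density hu _ hF)
    (fun g U => indicator_mul_invariant (fun U' => hui g U') (fun U' => hFi g U') U)
    (fun V y hne => by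
      -- `(𝟙{u<θ}·F)(W) ≠ 0` yields BOTH `u W < θ` and `F W ≠ 0`
      by_cases hlt : u (fixTo T U₀ (updateFinset V Λ y)) < εθ * η ^ 2
      · exact hreach' V y hlt (by
          rwa [indicator_of_mem (show fixTo T U₀ (updateFinset V Λ y) ∈ {U | u U < εθ * η ^ 2} from hlt)] at hne)
      · exact absurd (indicator_of_notMem (show fixTo T U₀ (updateFinset V Λ y) ∉ {U | u U < εθ * η ^ 2} from hlt) F)
          hne)
    hu hui hPu W
    (fun V x => {x' | u (fixTo T U₀ (updateFinset V Λ (expFibreChart Λ (c V) e x'))) < εθ * η ^ 2}.indicator (Jco V) x)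
    𝒢 W𝒱 h𝒢 hW hB₀ hC₄ hε₄ hdL hC₁ hε₁ hB₃ h1 h2 h3 H₁ hH₁ Φ hΦd hΦ0 hΦ hSr Cf hC₂ hCq hCd ιs hι Hop hH h18 hcoup h3R
    ℓs hκ hℓ hlen hκc hcurl 𝓔W 𝓔E hEW hBW hEE hBE hWlb hElb L 𝓡𝒵 𝓡𝒴' 𝓡𝒳 h𝓡𝒳 𝓡ℬ h𝒢r hWr hιr hHr hCr hH₁r hΦr
    (fun V x hx => by
      -- the restricted density's sections: S87 f1 `indicator_mul_section` against `hRdict`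
      by_cases hlt : u (fixTo T U₀ (updateFinset V Λ (expFibreChart Λ (c V) e x))) < εθ * η ^ 2
      · rw [indicator_of_mem (show fixTo T U₀ (updateFinset V Λ (expFibreChart Λ (c V) e x)) ∈
            {U | u U < εθ * η ^ 2} from hlt),
          indicator_of_mem (show x ∈ {x' | u (fixTo T U₀ (updateFinset V Λ (expFibreChart Λ (c V) e x'))) <
            εθ * η ^ 2} from hlt), hRdict V x hx]
      · rw [indicator_of_notMem (show fixTo T U₀ (updateFinset V Λ (expFibreChart Λ (c V) e x)) ∉
            {U | u U < εθ * η ^ 2} from hlt),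
          indicator_of_notMem (show x ∉ {x' | u (fixTo T U₀ (updateFinset V Λ (expFibreChart Λ (c V) e x'))) <
            εθ * η ^ 2} from hlt), zero_mul])
    hudict
    (fun V x hne => hJW V x fun h0 => hne (le_antisymm ((indicator_le_self _ _ x).trans_eq h0) bot_le))
    (fun V x a ha => by
      -- CENTRE-MONOTONICITY of the extra indicator: the sub-threshold set is star-shaped along the contraction (§2)
      by_cases hJx : Jco V x = 0
      · have h0 : {x' | u (fixTo T U₀ (updateFinset V Λ (expFibreChart Λ (c V) e x'))) < εθ * η ^ 2}.indicator
            (Jco V) x = 0 := le_antisymm ((indicator_le_self _ _ x).trans_eq hJx) bot_le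
        rw [h0]; exact bot_le
      by_cases hlt : u (fixTo T U₀ (updateFinset V Λ (expFibreChart Λ (c V) e x))) < εθ * η ^ 2
      · have hxW : x ∈ W V := hJW V x hJx
        have hxc : x ∈ cube m₀ S := hWc V x hxW
        have hxc' : Real.exp (-a) • x ∈ cube m₀ S :=
          mem_cube_of_mem_closedBall (exp_neg_smul_mem_closedBall (hWS V hxW) ha)
        have hc1 : Real.exp (-a) ≤ 1 := by rw [Real.exp_le_one_iff]; linarith
        have hlt1 := hlt
        rw [hudict V x hxc] at hlt1
        have hlt2 := classifier_lt_of_contraction hPu _ hRad1 hθ hδ0 hδ1.le hSM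
          (hAN_landau_chartRay_stokes hS (hWS V) (h𝒢 V) (hW V) hB₀ hC₄ hε₄ hdom hself' hcontr' (H₁ V) (hH₁ V)
            (hΦd V) (hΦ0 V) (hΦ V) hSr hC₂ (hCq V) (hCd V) (ιs V) (hι V) (Hop V) (hH V) hq hRC ℓs hκ hℓ hκc hcurl
            hlen x hxW)
          hlt1 (Real.exp_pos (-a)) hc1
        rw [← hudict V (Real.exp (-a) • x) hxc'] at hlt2
        rw [indicator_of_mem (show x ∈ {x' | u (fixTo T U₀ (updateFinset V Λ (expFibreChart Λ (c V) e x'))) <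
            εθ * η ^ 2} from hlt),
          indicator_of_mem (show Real.exp (-a) • x ∈ {x' | u (fixTo T U₀ (updateFinset V Λ
            (expFibreChart Λ (c V) e x'))) < εθ * η ^ 2} from hlt2)]
        exact hJ V x a ha
      · rw [indicator_of_notMem (show x ∉ {x' | u (fixTo T U₀ (updateFinset V Λ (expFibreChart Λ (c V) e x'))) <
            εθ * η ^ 2} from hlt)]
        exact bot_le)
    (fun V x => (indicator_le_self _ _ x).trans (hJ1 V x))
    hWS hδ0 hδ1 hρ0 hρ hβ hη hεθ hs₁ ha hma hsm
  -- S87 f1: (M1) for the restricted density ⟹ (M1) for the density, SAME constant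
  exact slotAntiConcentration_withDensity_of_indicator hu (by positivity) hρ0 h

end Final

end Summit.QuantumFields.BalabanUV.T4Continuum.ShellMeasureLandauEndWindowRestrictRel

end
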